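import Summits.NavierStokesRegularity.NavierStokesRegularity.Theorems.HardyPointSinkHardyAncientLimitPressureB
import Summits.NavierStokesRegularity.NavierStokesRegularity.Theorems.HardyPointSinkHardyAncientLimitPressureC
import Literature.Analysis.FluidPDE.LocalTypeILscPressure
import Literature.Analysis.FluidPDE.LocalTypeIProofs
import Literature.Analysis.FluidPDE.PineauVicolOneSliceGradient
import Literature.Analysis.FluidPDE.PressureDeterminedUpToTime
import Literature.Analysis.FluidPDE.SereginSverakBlowupLimit
import Literature.Analysis.FluidPDE.SereginSverakBlowupRepresentative
import Literature.Analysis.FluidPDE.SereginSverakPressureDecayBalls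
import Literature.Analysis.FluidPDE.ESSLocalHolderBlowupLimit
import Literature.Analysis.FluidPDE.ClassicalSuitable
import Literature.Analysis.FluidPDE.CKN1982Setting
import Literature.Analysis.FunctionSpaces.WeakCompactnessLpFinite
import Literature.Analysis.FunctionSpaces.DiagonalSubsequence
import HarnessLib

/-!
# Route HardyPointSink — `HardyAncientLimit`, step 8d: the scaled pressure quantity `D` of the
# blow-up limit — conclusion

Support file for item stmt-NavierStokesRegularity-9138 (`HardyAncientLimit`) of route
`HardyPointSink` (problem `NavierStokesRegularity`).

Let `(U_k, q_k)` be the rescaled classical solutions of the blow-up procedure, `U_{φ(j)} → w`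
locally uniformly on `{s ≤ 0} × ℝ³`, `(w, P)` the classical (smooth, bounded, ancient) limit
solution, and `D(Q(z,r); q_k) ≤ 𝐈₀` for large `k` on every parabolic ball below `s = 0`. Then
`D(Q(z,r); P) ≤ 𝐈₀` on every such ball (`HardyAncientLimit.cknDOsc_limit_le`): along a further
subsequence the gauged pressures converge weakly in `L^{3/2}_{loc}` to some `π`
(`HardyAncientLimit.exists_weakLimit_pressure`); passing to the limit in the distributional
momentum equations, `(w, π)` and `(w, P)` solve Navier–Stokes in `𝒟'` with the same velocity, so
`∇(P - π) = 0` in `𝒟'` and `P - π` is a function of time only (Rusin–Šverák 2011, §2;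
`ae_exists_const_of_forall_integral_mul_divergence_eq_zero`); `D` does not see functions of
time, and `D` of a weak limit is bounded by the `lim inf` (`cknDOsc_le_of_tendsto_weakly`).
This is the step "(3.6) follows from (3.3)" of Albritton–Barker 2019, §3, for the quantity `D`.

## References

* D. Albritton, T. Barker, arXiv:1811.00502, §3.
* W. Rusin, V. Šverák, J. Funct. Anal. 260 (2011), §2.
* G. Seregin, V. Šverák, Comm. PDE 34 (2009), §4.
-/

noncomputable section

open Literature.Analysis.FluidPDE Literature.Analysis.FluidPDE.SereginSverak2009
open Literature.Analysis.FunctionSpaces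
open MeasureTheory Set Function Filter Topology Metric TopologicalSpace
open scoped ENNReal NNReal InnerProductSpace RealInnerProductSpace Laplacian

namespace Summit.NavierStokesRegularity.NavierStokesRegularity.Theorems

namespace HardyAncientLimit

/-! ### Local integrability of the weak limit and the choice of levels -/

/-- The weak limit `π ∈ L^{3/2}(Q(0,m+2))` (all `m`) is locally integrable on every slab
`(T₁, 0) × ℝ³`. [folklore] -/
theorem locallyIntegrableOn_weakLimit {π : ℝ → EuclideanSpace ℝ (Fin 3) → ℝ}
    (hπ : ∀ m : ℕ, MemLp (uncurry π) (3 / 2)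
      (volume.restrict (parabolicCylinder ((m : ℝ) + 2) (0 : ℝ × EuclideanSpace ℝ (Fin 3)))))
    (T₁ : ℝ) :
    LocallyIntegrableOn (uncurry π) (Ioo T₁ 0 ×ˢ (univ : Set (EuclideanSpace ℝ (Fin 3)))) volume := by
  intro x hx
  obtain ⟨m, hm⟩ : ∃ m : ℕ, |x.1| + ‖x.2‖ < (m : ℝ) := exists_nat_gt _
  have hxQ : x ∈ parabolicCylinder ((m : ℝ) + 2) (0 : ℝ × EuclideanSpace ℝ (Fin 3)) := by
    rw [parabolicCylinder_zero_eq]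
    refine ⟨⟨?_, hx.1.2⟩, ?_⟩
    · have h1 : -x.1 ≤ |x.1| := neg_le_abs x.1
      have h2 : (m : ℝ) + 2 ≤ ((m : ℝ) + 2) ^ 2 := by nlinarith [m.cast_nonneg (α := ℝ)]
      linarith [norm_nonneg x.2]
    · rw [mem_ball_zero_iff]
      linarith [abs_nonneg x.1]
  haveI := isFiniteMeasure_restrict_parabolicCylinder ((m : ℝ) + 2)
    (0 : ℝ × EuclideanSpace ℝ (Fin 3))
  exact ⟨_, mem_nhdsWithin_of_mem_nhds ((isOpen_parabolicCylinder _ _).mem_nhds hxQ),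
    (hπ m).integrable threeHalves_facts.1⟩

/-- Every parabolic ball `Q(z, r)` below `s = 0` lies in some level `Q(0, m+2)`. [folklore] -/
theorem exists_level_superset {r : ℝ} (hr : 0 < r) {z : ℝ × EuclideanSpace ℝ (Fin 3)}
    (hz : z.1 ≤ 0) :
    ∃ m : ℕ, parabolicCylinder r z ⊆
      parabolicCylinder ((m : ℝ) + 2) (0 : ℝ × EuclideanSpace ℝ (Fin 3)) := by
  obtain ⟨m, hm⟩ : ∃ m : ℕ, |z.1| + r ^ 2 + ‖z.2‖ + r < (m : ℝ) := exists_nat_gt _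
  refine ⟨m, fun w hw => ?_⟩
  rw [mem_parabolicCylinder] at hw
  rw [parabolicCylinder_zero_eq]
  have h1 : -z.1 ≤ |z.1| := neg_le_abs z.1
  have h2 : (m : ℝ) + 2 ≤ ((m : ℝ) + 2) ^ 2 := by nlinarith [m.cast_nonneg (α := ℝ)]
  refine ⟨⟨by nlinarith [hw.1.1, norm_nonneg z.2], hw.1.2.trans_le hz⟩, ?_⟩
  rw [mem_ball_zero_iff]
  calc ‖w.2‖ ≤ ‖z.2‖ + dist w.2 z.2 := by
        rw [dist_eq_norm]
        exact norm_le_insert' _ _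
    _ < (m : ℝ) + 2 := by nlinarith [hw.2, abs_nonneg z.1]

/-! ### `D` does not see functions of time -/

/-- Adding a constant commutes with the mean over a set of finite positive measure, for an
integrable function. [folklore] -/
theorem setAverage_add_const {B : Set (EuclideanSpace ℝ (Fin 3))} (hB0 : volume B ≠ 0)
    (hBt : volume B ≠ ⊤) {f : EuclideanSpace ℝ (Fin 3) → ℝ} (hf : IntegrableOn f B volume)
    (c : ℝ) : ⨍ y in B, (f y + c) = (⨍ y in B, f y) + c := by
  have h := setAverage_sub_const hB0 hBt hf (-c)
  simp only [sub_neg_eq_add] at h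
  exact h

/-- **`D(Q(z,r); P) = D(Q(z,r); π)` when `P - π` is a function of time.** If `P` is continuous
on the slab of the ball, `π ∈ L^{3/2}(Q(z,r))`, and for a.e. `t ∈ (z.1 - r², z.1)` the slice
`P(t,·) - π(t,·)` is a.e. constant, then the mean-free parts agree a.e. on `Q(z,r)` (Tonelli
slice by slice). [cite: AlbrittonBarker2019, §3] -/
theorem cknDOsc_eq_of_ae_const {P π : ℝ → EuclideanSpace ℝ (Fin 3) → ℝ} {r : ℝ} (hr : 0 < r)
    {z : ℝ × EuclideanSpace ℝ (Fin 3)}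
    (hPc : ContinuousOn (uncurry P) (Ioo (z.1 - r ^ 2) z.1 ×ˢ univ))
    (hπ : MemLp (uncurry π) (3 / 2) (volume.restrict (parabolicCylinder r z)))
    (hconst : ∀ᵐ t ∂(volume.restrict (Ioo (z.1 - r ^ 2) z.1)), ∃ κ : ℝ,
      ∀ᵐ x ∂(volume : Measure (EuclideanSpace ℝ (Fin 3))), P t x - π t x = κ) :
    cknDOsc r z P = cknDOsc r z π := by
  set I : Set ℝ := Ioo (z.1 - r ^ 2) z.1 with hI
  set Bz : Set (EuclideanSpace ℝ (Fin 3)) := ball z.2 r with hBz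
  have hQ : parabolicCylinder r z = I ×ˢ Bz := rfl
  have hB0 : volume Bz ≠ 0 := (measure_ball_pos volume z.2 hr).ne'
  have hBt : volume Bz ≠ ⊤ := measure_ball_lt_top.ne
  haveI := isFiniteMeasure_restrict_parabolicCylinder r z
  -- measurability of the two integrands
  have hPm : AEStronglyMeasurable (uncurry P) (volume.restrict (I ×ˢ Bz)) :=
    (hPc.mono (prod_mono le_rfl (subset_univ _))).aestronglyMeasurable
      (measurableSet_Ioo.prod measurableSet_ball)
  have hπm : AEStronglyMeasurable (uncurry π) (volume.restrict (I ×ˢ Bz)) := hπ.aestronglyMeasurable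
  have hFP : AEMeasurable (fun w : ℝ × EuclideanSpace ℝ (Fin 3) =>
      ‖P w.1 w.2 - ⨍ y in Bz, P w.1 y‖ₑ ^ (3 / 2 : ℝ)) ((volume.restrict I).prod (volume.restrict Bz)) := by
    have := ((hPm.sub (aestronglyMeasurable_setAverage_slice hPm)).aemeasurable.enorm.pow_const
      (3 / 2 : ℝ))
    rw [volume_restrict_prod_eq] at this
    exact this
  have hFπ : AEMeasurable (fun w : ℝ × EuclideanSpace ℝ (Fin 3) =>
      ‖π w.1 w.2 - ⨍ y in Bz, π w.1 y‖ₑ ^ (3 / 2 : ℝ)) ((volume.restrict I).prod (volume.restrict Bz)) := by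
    have := ((hπm.sub (aestronglyMeasurable_setAverage_slice hπm)).aemeasurable.enorm.pow_const
      (3 / 2 : ℝ))
    rw [volume_restrict_prod_eq] at this
    exact this
  -- slice integrability of `π`
  have hπI : Integrable (uncurry π) ((volume.restrict I).prod (volume.restrict Bz)) := by
    have := hπ.integrable threeHalves_facts.1
    rwa [hQ, volume_restrict_prod_eq] at this
  unfold cknDOsc
  congr 1
  rw [hQ, volume_restrict_prod_eq, lintegral_prod _ hFP, lintegral_prod _ hFπ]
  refine lintegral_congr_ae ?_
  filter_upwards [hconst, hπI.prod_right_ae, ae_restrict_mem measurableSet_Ioo] with t ht hπt htI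
  obtain ⟨κ, hκ⟩ := ht
  have hπt' : IntegrableOn (π t) Bz volume := hπt
  -- the means differ by `κ`
  have hae : (fun y => P t y) =ᵐ[volume.restrict Bz] fun y => π t y + κ :=
    ae_restrict_of_ae (hκ.mono fun x hx => by rw [← hx]; ring)
  have havg : ⨍ y in Bz, P t y = (⨍ y in Bz, π t y) + κ := by
    rw [show (⨍ y in Bz, P t y) = ⨍ y in Bz, (π t y + κ) from average_congr hae,
      setAverage_add_const hB0 hBt hπt' κ]
  refine lintegral_congr_ae ?_
  filter_upwards [ae_restrict_of_ae (μ := volume) (s := Bz) hκ] with x hx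
  rw [havg, show P t x - ((⨍ y in Bz, π t y) + κ) = π t x - ⨍ y in Bz, π t y by linarith]

/-! ### The bound `D(Q(z,r); P) ≤ 𝐈₀` -/

/-- **`D` of the blow-up limit's pressure is bounded by `𝐈₀`** (Albritton–Barker 2019, §3,
"(3.6) follows from (3.3)" for `D`). Hypotheses: the rescaled velocities `U_k` are continuous on
`{s ≤ 0} × ℝ³` and bounded by `1` on each `Q(N+1)` for large `k`, and `U_{φ(j)} → w` uniformly
on each `Q(N+1)`; the rescaled pressures `q_k` are continuous on `{s ≤ 0} × ℝ³`, `(U_k, q_k)`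
solve Navier–Stokes in `𝒟'(Q(N+1))` for large `k`, and `D(Q(z,r); q_k) ≤ 𝐈₀ < ∞` for large `k`
on every parabolic ball below `s = 0`; `(w, P)` is a classical solution on `s < 0`. Conclusion:
`D(Q(z,r); P) ≤ 𝐈₀` for every `r > 0` and `z.1 ≤ 0`. [cite: AlbrittonBarker2019, §3 (3.3)–(3.6)] -/
theorem cknDOsc_limit_le
    {U : ℕ → ℝ → EuclideanSpace ℝ (Fin 3) → EuclideanSpace ℝ (Fin 3)}
    {Pq : ℕ → ℝ → EuclideanSpace ℝ (Fin 3) → ℝ} {φ : ℕ → ℕ}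
    {w : ℝ → EuclideanSpace ℝ (Fin 3) → EuclideanSpace ℝ (Fin 3)}
    {P : ℝ → EuclideanSpace ℝ (Fin 3) → ℝ} {I₀ : ℝ≥0∞} (hφ : StrictMono φ)
    (hUc : ∀ a : ℝ, 0 < a → ∀ᶠ k in atTop, ContinuousOn (uncurry (U k)) (parCylTop a))
    (hUb : ∀ a : ℝ, 0 < a → ∀ᶠ k in atTop, ∀ z ∈ parCylTop a, ‖U k z.1 z.2‖ ≤ 1)
    (hunif : ∀ N : ℕ, TendstoUniformlyOn (fun j => uncurry (U (φ j))) (uncurry w) atTop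
      (parCyl 0 ((N : ℝ) + 1)))
    (hPc : ∀ᶠ k in atTop, ContinuousOn (uncurry (Pq k)) (Iic 0 ×ˢ univ))
    (hNS : ∀ N : ℕ, ∀ᶠ k in atTop,
      IsDistributionalNSSolutionOn (parCylOpens 0 ((N : ℝ) + 1)) 1 0 (U k) (Pq k))
    (hD : ∀ r : ℝ, 0 < r → ∀ z : ℝ × EuclideanSpace ℝ (Fin 3), z.1 ≤ 0 →
      ∀ᶠ k in atTop, cknDOsc r z (Pq k) ≤ I₀)
    (hI : I₀ ≠ ⊤) (hcl : IsClassicalNSSolutionOn (Iio 0) 1 0 w P) :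
    ∀ r : ℝ, 0 < r → ∀ z : ℝ × EuclideanSpace ℝ (Fin 3), z.1 ≤ 0 → cknDOsc r z P ≤ I₀ := by
  obtain ⟨χ, π, hχ, hπ⟩ := exists_weakLimit_pressure hφ hPc hD hI
  have hη : StrictMono (φ ∘ χ) := hφ.comp hχ
  have hunif' : ∀ N : ℕ, TendstoUniformlyOn (fun j => uncurry (U ((φ ∘ χ) j))) (uncurry w) atTop
      (parCyl 0 ((N : ℝ) + 1)) := fun N u hu => hχ.tendsto_atTop.eventually (hunif N u hu)
  -- the identity on every slab, local integrability, constancy in `x`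
  have hid : ∀ T₁ : ℝ, ∀ ψ : ℝ → EuclideanSpace ℝ (Fin 3) → EuclideanSpace ℝ (Fin 3),
      IsSpaceTimeTestOn (slab (EuclideanSpace ℝ (Fin 3)) (Ioo T₁ 0) isOpen_Ioo) ψ →
      ∫ z in Ioo T₁ 0 ×ˢ (univ : Set (EuclideanSpace ℝ (Fin 3))),
        (fun t x => P t x - π t x) z.1 z.2 * VectorCalculus.divergence (ψ z.1) z.2 = 0 :=
    fun T₁ ψ hψ => setIntegral_sub_mul_divergence_eq_zero hη hUc hUb hunif' hPc hNS hcl hπ hψ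
  have hF : ∀ T₁ : ℝ, LocallyIntegrableOn (uncurry fun t x => P t x - π t x)
      (Ioo T₁ 0 ×ˢ (univ : Set (EuclideanSpace ℝ (Fin 3)))) volume := by
    intro T₁
    have e : (uncurry fun t x => P t x - π t x) = uncurry P - uncurry π := rfl
    rw [e]
    refine LocallyIntegrableOn.sub ?_ (locallyIntegrableOn_weakLimit (fun m => (hπ m).1) T₁)
    exact (hcl.smooth_pressure.continuousOn.mono (prod_mono (fun t ht => ht.2) le_rfl)).locallyIntegrableOn
      (measurableSet_Ioo.prod MeasurableSet.univ)
  have hconst : ∀ T₁ : ℝ, ∀ᵐ t ∂(volume.restrict (Ioo T₁ 0)), ∃ κ : ℝ,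
      ∀ᵐ x ∂(volume : Measure (EuclideanSpace ℝ (Fin 3))), P t x - π t x = κ :=
    fun T₁ => ae_exists_const_of_forall_integral_mul_divergence_eq_zero (hF T₁) (hid T₁)
  -- the bound on a fixed ball
  intro r hr z hz
  obtain ⟨m, hQm⟩ := exists_level_superset hr hz
  have hIT : Ioo (z.1 - r ^ 2) z.1 ⊆ Ioo (-(((m : ℝ) + 2) ^ 2)) 0 := by
    intro t ht
    have hw : ((t, z.2) : ℝ × EuclideanSpace ℝ (Fin 3)) ∈ parabolicCylinder r z :=
      ⟨ht, mem_ball_self hr⟩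
    have h2 := hQm hw
    rw [parabolicCylinder_zero_eq] at h2
    exact h2.1
  have hconstI : ∀ᵐ t ∂(volume.restrict (Ioo (z.1 - r ^ 2) z.1)), ∃ κ : ℝ,
      ∀ᵐ x ∂(volume : Measure (EuclideanSpace ℝ (Fin 3))), P t x - π t x = κ :=
    ae_restrict_of_ae_restrict_of_subset hIT (hconst _)
  have hPc' : ContinuousOn (uncurry P) (Ioo (z.1 - r ^ 2) z.1 ×ˢ univ) :=
    hcl.smooth_pressure.continuousOn.mono (prod_mono (fun t ht => (ht.2.trans_le hz : t < 0)) le_rfl)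
  have hπr : MemLp (uncurry π) (3 / 2) (volume.restrict (parabolicCylinder r z)) :=
    (hπ m).1.mono_measure (Measure.restrict_mono hQm le_rfl)
  rw [cknDOsc_eq_of_ae_const hr hPc' hπr hconstI]
  -- weak lower semicontinuity of `D` along the (shifted) gauged sequence
  have hev : ∀ᶠ j in atTop, ContinuousOn (uncurry (Pq ((φ ∘ χ) j))) (Iic 0 ×ˢ univ) ∧
      cknDOsc r z (Pq ((φ ∘ χ) j)) ≤ I₀ :=
    hη.tendsto_atTop.eventually (hPc.and (hD r hr z hz))
  obtain ⟨j₀, hj₀⟩ := eventually_atTop.1 hev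
  haveI := isFiniteMeasure_restrict_parabolicCylinder ((m : ℝ) + 2)
    (0 : ℝ × EuclideanSpace ℝ (Fin 3))
  have hlev : MeasurableSet (parabolicCylinder ((m : ℝ) + 2) (0 : ℝ × EuclideanSpace ℝ (Fin 3))) :=
    (isOpen_parabolicCylinder _ _).measurableSet
  -- the compact box containing the level
  set S : Set (ℝ × EuclideanSpace ℝ (Fin 3)) :=
    Icc (-(((m : ℝ) + 2) ^ 2)) 0 ×ˢ closedBall (0 : EuclideanSpace ℝ (Fin 3)) ((m : ℝ) + 2) with hS
  have hSc : IsCompact S := isCompact_Icc.prod (isCompact_closedBall _ _)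
  have hSsub : S ⊆ Iic (0 : ℝ) ×ˢ (univ : Set (EuclideanSpace ℝ (Fin 3))) :=
    fun w hw => ⟨hw.1.2, mem_univ _⟩
  have hQS : parabolicCylinder ((m : ℝ) + 2) (0 : ℝ × EuclideanSpace ℝ (Fin 3)) ⊆ S := by
    rw [parabolicCylinder_zero_eq]
    exact prod_mono Ioo_subset_Icc_self ball_subset_closedBall
  refine cknDOsc_le_of_tendsto_weakly hr hQm
    (q := fun j s y => Pq ((φ ∘ χ) (j + j₀)) s y -
      ⨍ y' in closedBall (0 : EuclideanSpace ℝ (Fin 3)) 1, Pq ((φ ∘ χ) (j + j₀)) (min s 0) y')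
    (fun j => ?_) (hπ m).1 (fun g hg => ((hπ m).2 g hg).comp (tendsto_add_atTop_nat j₀))
    (fun j => ?_)
  · have hc := continuousOn_gauged (hj₀ (j + j₀) (Nat.le_add_left _ _)).1
    obtain ⟨M, hM⟩ := hSc.exists_bound_of_continuousOn (hc.mono hSsub)
    refine MemLp.of_bound ((hc.mono (hQS.trans hSsub)).aestronglyMeasurable hlev) M ?_
    filter_upwards [ae_restrict_mem hlev] with w hw using hM w (hQS hw)
  · show cknDOsc r z (fun s y => Pq ((φ ∘ χ) (j + j₀)) s y -
      ⨍ y' in closedBall (0 : EuclideanSpace ℝ (Fin 3)) 1, Pq ((φ ∘ χ) (j + j₀)) (min s 0) y') ≤ I₀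
    rw [cknDOsc_gauged (hj₀ _ (Nat.le_add_left _ _)).1 hr hz]
    exact (hj₀ _ (Nat.le_add_left _ _)).2

/-! ### Two invariances of `D` used by the assembly -/

/-- `D(Q(z,r); q)` only depends on the slices `q(t, ·)`, `t ∈ (z.1 - r², z.1)`. [folklore] -/
theorem cknDOsc_congr_slices {q q' : ℝ → EuclideanSpace ℝ (Fin 3) → ℝ} {r : ℝ}
    {z : ℝ × EuclideanSpace ℝ (Fin 3)} (h : ∀ t ∈ Ioo (z.1 - r ^ 2) z.1, q t = q' t) :
    cknDOsc r z q = cknDOsc r z q' := by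
  unfold cknDOsc
  congr 1
  refine setLIntegral_congr_fun (isOpen_parabolicCylinder r z).measurableSet fun w hw => ?_
  have ht : w.1 ∈ Ioo (z.1 - r ^ 2) z.1 := hw.1
  simp only [h w.1 ht]

/-- **`D` is invariant under subtracting a function of time** (slice-integrable version): if
every slice `q(t, ·)`, `t ∈ (z.1 - r², z.1)`, is locally integrable, then for `r > 0` and any
`c : ℝ → ℝ`, `D(Q(z,r); q - c) = D(Q(z,r); q)`. [cite: AlbrittonBarker2019, §3] -/
theorem cknDOsc_sub_timeFun' {q : ℝ → EuclideanSpace ℝ (Fin 3) → ℝ} {r : ℝ}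
    {z : ℝ × EuclideanSpace ℝ (Fin 3)}
    (hq : ∀ t ∈ Ioo (z.1 - r ^ 2) z.1, LocallyIntegrable (q t) volume) (c : ℝ → ℝ) (hr : 0 < r) :
    cknDOsc r z (fun t x => q t x - c t) = cknDOsc r z q := by
  unfold cknDOsc
  congr 1
  refine setLIntegral_congr_fun (isOpen_parabolicCylinder r z).measurableSet fun w hw => ?_
  have ht : w.1 ∈ Ioo (z.1 - r ^ 2) z.1 := hw.1
  have hint : IntegrableOn (q w.1) (ball z.2 r) volume :=
    ((hq w.1 ht).integrableOn_isCompact (isCompact_closedBall z.2 r)).mono_set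
      ball_subset_closedBall
  simp only
  rw [setAverage_sub_const (measure_ball_pos volume z.2 hr).ne' measure_ball_lt_top.ne hint (c w.1)]
  ring_nf

end HardyAncientLimit

end Summit.NavierStokesRegularity.NavierStokesRegularity.Theorems

end
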